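import Mathlib
import HarnessLib
import Summits.HubbardSuperconductivity.HubbardSuperconductivity.Theorems.KLProgrammeKLRegimeSplitLegStaging
import Summits.HubbardSuperconductivity.HubbardSuperconductivity.Theorems.KLProgrammeKLRegimeSplitPairValueBridge

/-!
# Route `KLProgramme` — crux K3 (stmt-HubbardSuperconductivity-19937), child 1: the endpoint closers for the `Q`-AWARE split clause
# (`quarticValue_pair_le_of_pairArrayAtV2`, `quarticValueS2_le_of_pairArrayAtV2`, `quarticValueLineS_of_pairArrayAtV2`, `endpointLineS_of_V2`;
# cell gate-hubbard-kl, seat p1 = C1 lead, g5)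

Twins of `…SplitPairValueBridge` / `…SplitChildOneClosersS` (p443794 / p446050) for `PairArrayAtV2` of `…SplitLegStaging` (Δ15, p450191): the
`(0,1)` pair-class values are bounded by `B₂ := 2|U| + (P.C_W + klLegKappa·Q.CR·P.Klam³)·U²` on the ball, hence the `(0,1)` value line and — with
(E5-S) `IsoTupleL1AtS` — `EndpointLineS n`, under the side conditions `G.CF·B₂ + G.CF·(Klam U)² ≤ Klam·|U|` and `B₂ ≤ Klam·|U|` (both met for
`U ≤ U₀(G, P, Q)`, which child 1 chooses after `Q`).  Pure bookkeeping.
-/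

noncomputable section

namespace Summit.HubbardSuperconductivity.HubbardSuperconductivity.Theorems.KLRegimeSplit

set_option linter.dupNamespace false -- summit = problem name (single-conjunct summit), D-0017

open Real Literature.MathematicalPhysics.QuantumLattice Literature.Probability.LatticeModels

section Model

variable (L M : ℕ) [NeZero L] [NeZero M]

/-- **Pair-class `(0,1)` values from (B1-v2′)**: `PairArrayAtV2 n` gives `‖λₙ^{↑↓}(k′, k, Q−k′)‖ ≤ 2|U| + (C_W + κ₀·CR·Klam³)·U²` for `k, k′` in the ball. -/
theorem quarticValue_pair_le_of_pairArrayAtV2 (P : SplitConsts) (Q : EngConsts) {β U μ : ℝ} {K : TrigPolyC4v} {n : ℕ}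
    (h : PairArrayAtV2 L M P Q β U μ K n) (Qm : TorusSite 2 L) {k k' : TorusSite 2 L} (hk : k ∈ klBall L μ K)
    (hk' : k' ∈ klBall L μ K) :
    ‖klQuarticValue L M β U μ K n 0 1 k' k (Qm - k')‖ ≤ 2 * |U| + (P.C_W + klLegKappa * Q.CR * P.Klam ^ 3) * U ^ 2 := by
  obtain ⟨u, hu0, hu2, hdev⟩ := h Qm
  rw [klQuarticValue_pair]
  have hd := hdev k hk k' hk'
  calc ‖klPairAmplitude L M β U μ K n Qm k k'‖
      = ‖(klPairAmplitude L M β U μ K n Qm k k' - (u : ℂ)) + (u : ℂ)‖ := by rw [sub_add_cancel]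
    _ ≤ ‖klPairAmplitude L M β U μ K n Qm k k' - (u : ℂ)‖ + ‖(u : ℂ)‖ := norm_add_le _ _
    _ ≤ (P.C_W + klLegKappa * Q.CR * P.Klam ^ 3) * U ^ 2 + 2 * |U| := by
        rw [Complex.norm_real, Real.norm_eq_abs, abs_of_nonneg hu0]; exact add_le_add hd hu2
    _ = 2 * |U| + (P.C_W + klLegKappa * Q.CR * P.Klam ^ 3) * U ^ 2 := by ring

/-- **`(0,1)` values at `(k₁, k₂, k₃)` with `k₁, k₂` in the ball (any `k₃`)** from `PairArrayAtV2 n`. -/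
theorem quarticValueS2_le_of_pairArrayAtV2 (P : SplitConsts) (Q : EngConsts) {β U μ : ℝ} {K : TrigPolyC4v} {n : ℕ}
    (h : PairArrayAtV2 L M P Q β U μ K n) {k₁ k₂ : TorusSite 2 L} (hk₁ : k₁ ∈ klBall L μ K) (hk₂ : k₂ ∈ klBall L μ K)
    (k₃ : TorusSite 2 L) :
    ‖klQuarticValue L M β U μ K n 0 1 k₁ k₂ k₃‖ ≤ 2 * |U| + (P.C_W + klLegKappa * Q.CR * P.Klam ^ 3) * U ^ 2 := by
  have hk₃ : k₃ = (k₁ + k₃) - k₁ := by abel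
  rw [hk₃]
  exact quarticValue_pair_le_of_pairArrayAtV2 L M P Q h (k₁ + k₃) hk₂ hk₁

/-- **The `(0,1)` value line from (B1-v2′) alone** (given `2|U| + (C_W + κ₀·CR·Klam³)U² ≤ Klam·|U|`). -/
theorem quarticValueLineS_of_pairArrayAtV2 (P : SplitConsts) (Q : EngConsts) {β U μ : ℝ} {K : TrigPolyC4v} {n : ℕ}
    (h : PairArrayAtV2 L M P Q β U μ K n) (hK : 2 * |U| + (P.C_W + klLegKappa * Q.CR * P.Klam ^ 3) * U ^ 2 ≤ P.Klam * |U|) :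
    QuarticValueLineS L M P β U μ K n :=
  fun _ hk₁ _ hk₂ k₃ _ => (quarticValueS2_le_of_pairArrayAtV2 L M P Q h hk₁ hk₂ k₃).trans hK

/-- **`EndpointLineS n` from (B1-v2′) + (E5-S)**: with `B₂ := 2|U| + (C_W + κ₀·CR·Klam³)U²`, if `0 ≤ B₂`, `CF·B₂ + CF·(Klam U)² ≤ Klam·|U|` and
`B₂ ≤ Klam·|U|`, then `PairArrayAtV2 n ∧ IsoTupleL1AtS n` give `EndpointLineS n`. -/
theorem endpointLineS_of_V2 {G : GeoConsts} (P : SplitConsts) (Q : EngConsts) {β U μ : ℝ} {K : TrigPolyC4v} {n : ℕ}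
    (hU : 0 ≤ 2 * |U| + (P.C_W + klLegKappa * Q.CR * P.Klam ^ 3) * U ^ 2)
    (hpair : PairArrayAtV2 L M P Q β U μ K n) (hiso : IsoTupleL1AtS L M G P β U μ K n)
    (harith : G.CF * (2 * |U| + (P.C_W + klLegKappa * Q.CR * P.Klam ^ 3) * U ^ 2) + G.CF * (P.Klam * U) ^ 2 ≤ P.Klam * |U|)
    (hK : 2 * |U| + (P.C_W + klLegKappa * Q.CR * P.Klam ^ 3) * U ^ 2 ≤ P.Klam * |U|) : EndpointLineS L M P β U μ K n := by
  refine ⟨?_, quarticValueLineS_of_pairArrayAtV2 L M P Q hpair hK⟩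
  intro Ω hΩ x₁
  have h' := hiso (2 * |U| + (P.C_W + klLegKappa * Q.CR * P.Klam ^ 3) * U ^ 2) hU
    (fun k₁ hk₁ k₂ hk₂ k₃ _ => quarticValueS2_le_of_pairArrayAtV2 L M P Q hpair hk₁ hk₂ k₃) n le_rfl Ω hΩ x₁
  rw [klIsoKernelAt_self] at h'
  exact h'.trans harith

end Model

end Summit.HubbardSuperconductivity.HubbardSuperconductivity.Theorems.KLRegimeSplit

end
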